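import Summits.Ventures.PercRepro.S1CFGTrianglesAllTools

/-!
# PercRepro — THE TRIANGLE CAP FOR EVERY `n ≥ ν + 3` (p1, gen 40)

`M` a finite matroid on `E`, `|E| = n = rk E + ν`, coloop-free, with no dependent pair (SIMPLE);
`c₃ := #{X ⊆ E : |X| = 3, rk X ≤ 2}` (the triangles). The landed caps `c₃ ≤ C(ν + 1, 3) + 1` need
`n ≥ 2ν + 2` (S1CFGTriangles) and `n ≥ 2ν + 1` (S1CFGTrianglesTwo). THIS FILE: the same cap for
EVERY `n ≥ ν + 3` when `ν ≥ 3` (`ncard_three_eRk_le_two_le_choose_succ_add_one_of_add_three_le`),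
in particular at `n = 2ν` (the lane's open lever) — sharp at `n = ν + 3` (a `(ν + 1)`-point line and
a triangle through one of its points) and at `n = ν + 4` (the line and a disjoint triangle).

THE PROOF (induction on `ν` from `3`; no potential). Dichotomy on a SERIES PAIR `e ≠ f`, i.e.
`f ∉ cl (E ∖ {e, f})`:
* a series pair is symmetric (`notMem_closure_sdiff_pair_symm`: `rk (E ∖ e) = rk (E ∖ f) = rk E`);
  every rank-`2` triple through `e` contains `f` (else `e ∈ cl (E ∖ {e, f})`), and two of them,
  `{e, f, x}`, `{e, f, y}`, give the rank-`≤ 2` triple `{e, x, y}` avoiding `f` — so AT MOST ONE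
  triangle contains `e` (`ncard_three_eRk_le_two_mem_le_one`), and `c₃ ≤ c₃(E ∖ e) + 1 ≤
  C(ν + 1, 3) + 1` by the CRUDE landed cap on the restriction (nullity `ν − 1`; no coloop-freeness
  needed) — for EVERY `n`;
* no series pair: every restriction `M ↾ (E ∖ e)` is coloop-free (`restrict_isColoop_iff`), simple,
  of nullity `ν − 1` on `n − 1 ≥ (ν − 1) + 3` points, so the cap at `ν − 1` (the induction
  hypothesis; at `ν − 1 = 2` the landed cap of S1CFGTrianglesTwo, `n − 1 ≥ 5 = 2·2 + 1`) gives
  `c₃(E ∖ e) ≤ C(ν, 3) + 1`; the double count over the pairs `(e, X)` with `e ∉ X`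
  (`mul_ncard_three_eRk_le_two_le`) gives `(n − 3)·c₃ ≤ n·(C(ν, 3) + 1)`, and
  `c₃ ≥ C(ν + 1, 3) + 2` would force `n·(q + 1) ≤ (ν + 1)·q + 6` with `q = C(ν, 2) ≥ 3`
  (`3·C(ν + 1, 3) = (ν + 1)·C(ν, 2)`), false for `n ≥ ν + 3` (`le_choose_succ_add_one_of_mul_le`).

Numerals: `c₃ ≤ 21 / 36 / 57` at `ν = 5 / 6 / 7` on `n ≥ 8 / 9 / 10` points (the regimes `(6, 12)`
of the row `p = 11`). Nothing about any cell is claimed. Axioms: standard.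
-/

open scoped Matroid

namespace PercRepro

namespace S1CFG

open Set S1CF

variable {α : Type}

/-- **THE RESTRICTION TO `E ∖ {e}` UNDER «NO SERIES PAIR AT `e`»**: if every `f ≠ e` lies in `cl (E ∖ {e, f})`
then `M ↾ (E ∖ {e})` is simple, coloop-free, of nullity `ν − 1` on `n − 1` points, and any cap valid for such
matroids bounds `c₃(E ∖ e)`. -/
theorem ncard_three_eRk_le_two_sdiff_le_of_cap (M : Matroid α) [M.Finite] {ν : ℕ}
    (hd : M.E.encard = M.eRank + (ν : ℕ∞)) (hK : ∀ e, ¬ M.IsColoop e)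
    (h0 : {P : Set α | P ⊆ M.E ∧ P.ncard = 2 ∧ M.Dep P}.ncard = 0) {e : α} (he : e ∈ M.E)
    (hser : ∀ f ∈ M.E, f ≠ e → f ∈ M.closure (M.E \ {e, f})) {B : ℕ}
    (hcap : ∀ (N : Matroid α) [N.Finite], N.E.encard = N.eRank + ((ν - 1 : ℕ) : ℕ∞) →
      (∀ x, ¬ N.IsColoop x) → {P : Set α | P ⊆ N.E ∧ P.ncard = 2 ∧ N.Dep P}.ncard = 0 →
      ν - 1 + 3 ≤ N.E.ncard → {X : Set α | X ⊆ N.E ∧ X.ncard = 3 ∧ N.eRk X ≤ 2}.ncard ≤ B)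
    (hn : ν + 3 ≤ M.E.ncard) (hν : 1 ≤ ν) :
    {X : Set α | X ⊆ M.E \ {e} ∧ X.ncard = 3 ∧ M.eRk X ≤ 2}.ncard ≤ B := by
  have hEfin := M.ground_finite
  set S := M.E \ {e} with hS
  have hSE : S ⊆ M.E := sdiff_subset
  have hSfin : S.Finite := hEfin.subset hSE
  haveI : (M ↾ S).Finite := M.restrict_finite hSfin
  have hrk : M.eRk S = M.eRk M.E := eRk_sdiff_singleton_eq_of_not_isColoop M he (hK e)
  have hnE := ncard_ground_eq_eRk_toNat_add M hd
  have hcard : S.ncard = M.E.ncard - 1 := Set.ncard_sdiff_singleton_of_mem he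
  obtain ⟨r, hr⟩ : ∃ r : ℕ, M.eRk M.E = r := ⟨_, (S1.coe_toNat_eRk M (subset_refl M.E)).symm⟩
  have hrE : (M.eRk M.E).toNat = r := by rw [hr]; exact ENat.toNat_coe r
  have hd' : (M ↾ S).E.encard = (M ↾ S).eRank + ((ν - 1 : ℕ) : ℕ∞) := by
    rw [Matroid.restrict_ground_eq, Matroid.eRank_restrict, hrk, hr, ← hSfin.cast_ncard_eq, ← Nat.cast_add]
    congr 1
    omega
  have hK' : ∀ x, ¬ (M ↾ S).IsColoop x := by
    intro x hx
    rw [Matroid.restrict_isColoop_iff hSE] at hx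
    obtain ⟨hxcl, hxS⟩ := hx
    have hxe : x ≠ e := fun hxe => hxS.2 (by rw [hxe]; exact mem_singleton e)
    rw [hS, sdiff_singleton_sdiff_singleton_eq] at hxcl
    exact hxcl (hser x hxS.1 hxe)
  have h0' : {P : Set α | P ⊆ (M ↾ S).E ∧ P.ncard = 2 ∧ (M ↾ S).Dep P}.ncard = 0 := by
    rw [Set.ncard_eq_zero (hSfin.finite_subsets.subset (fun P hP => hP.1))]
    rw [Set.eq_empty_iff_forall_notMem]
    intro P hP
    obtain ⟨hPS, hP2, hPdep⟩ := hP
    rw [Matroid.restrict_ground_eq] at hPS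
    rw [Matroid.restrict_dep_iff] at hPdep
    have hPind := indep_of_ncard_eq_two_of_no_dep_pair M h0 (hPS.trans hSE) hP2
    exact hPdep.1 hPind
  have hn' : ν - 1 + 3 ≤ (M ↾ S).E.ncard := by
    rw [Matroid.restrict_ground_eq]
    omega
  have hres := hcap (M ↾ S) hd' hK' h0' hn'
  have hset : {X : Set α | X ⊆ (M ↾ S).E ∧ X.ncard = 3 ∧ (M ↾ S).eRk X ≤ 2} =
      {X : Set α | X ⊆ S ∧ X.ncard = 3 ∧ M.eRk X ≤ 2} := by
    ext X
    simp only [Set.mem_setOf_eq, Matroid.restrict_ground_eq]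
    constructor
    · rintro ⟨hXS, hX3, hXr⟩
      rw [Matroid.restrict_eRk_eq M hXS] at hXr
      exact ⟨hXS, hX3, hXr⟩
    · rintro ⟨hXS, hX3, hXr⟩
      rw [Matroid.restrict_eRk_eq M hXS]
      exact ⟨hXS, hX3, hXr⟩
  rw [hset] at hres
  exact hres

/-- **THE AVERAGING DOUBLE COUNT**: if every `E ∖ {e}` carries at most `B` rank-`2` triples then
`(n − 3)·c₃ ≤ n·B` (every triple is avoided by exactly `n − 3` points). -/
theorem mul_ncard_three_eRk_le_two_le (M : Matroid α) [M.Finite] {B : ℕ}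
    (hB : ∀ e ∈ M.E, {X : Set α | X ⊆ M.E \ {e} ∧ X.ncard = 3 ∧ M.eRk X ≤ 2}.ncard ≤ B) :
    (M.E.ncard - 3) * {X : Set α | X ⊆ M.E ∧ X.ncard = 3 ∧ M.eRk X ≤ 2}.ncard ≤ M.E.ncard * B := by
  classical
  have hEfin := M.ground_finite
  set E' := hEfin.toFinset with hE'
  have hmemE' : ∀ x, x ∈ E' ↔ x ∈ M.E := fun x => Set.Finite.mem_toFinset hEfin
  have hcardE' : E'.card = M.E.ncard := (Set.ncard_eq_toFinset_card M.E hEfin).symm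
  set 𝒯 := (E'.powersetCard 3).filter (fun X : Finset α => M.eRk (X : Set α) ≤ 2) with h𝒯
  have hT : {X : Set α | X ⊆ M.E ∧ X.ncard = 3 ∧ M.eRk X ≤ 2}.ncard = 𝒯.card :=
    ncard_family_eq_card_filter M 3 (fun X => M.eRk X ≤ 2)
  rw [hT, ← hcardE']
  have key := Finset.sum_card_bipartiteAbove_eq_sum_card_bipartiteBelow (s := E') (t := 𝒯)
    (fun (e : α) (X : Finset α) => e ∉ X)
  -- every triple is missed by exactly `n − 3` points
  have hR : ∀ X ∈ 𝒯, (E'.bipartiteBelow (fun (e : α) (X : Finset α) => e ∉ X) X).card = E'.card - 3 := by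
    intro X hX𝒯
    rw [h𝒯, Finset.mem_filter, Finset.mem_powersetCard] at hX𝒯
    have : E'.bipartiteBelow (fun (e : α) (X : Finset α) => e ∉ X) X = E' \ X := by
      ext e
      rw [Finset.mem_bipartiteBelow, Finset.mem_sdiff]
    rw [this, Finset.card_sdiff_of_subset hX𝒯.1.1, hX𝒯.1.2]
  -- every point misses at most `B` triples
  have hL : ∀ e ∈ E', (𝒯.bipartiteAbove (fun (e : α) (X : Finset α) => e ∉ X) e).card ≤ B := by
    intro e heE'
    have heE : e ∈ M.E := (hmemE' e).1 heE'
    have hfam : (𝒯.bipartiteAbove (fun (e : α) (X : Finset α) => e ∉ X) e).card =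
        {X : Set α | X ⊆ M.E ∧ X.ncard = 3 ∧ (M.eRk X ≤ 2 ∧ e ∉ X)}.ncard := by
      rw [ncard_family_eq_card_filter M 3 (fun X => M.eRk X ≤ 2 ∧ e ∉ X)]
      congr 1
      ext X
      rw [Finset.mem_bipartiteAbove, h𝒯, Finset.mem_filter, Finset.mem_filter, Finset.mem_coe]
      tauto
    rw [hfam]
    have hsub : {X : Set α | X ⊆ M.E ∧ X.ncard = 3 ∧ (M.eRk X ≤ 2 ∧ e ∉ X)} ⊆
        {X : Set α | X ⊆ M.E \ {e} ∧ X.ncard = 3 ∧ M.eRk X ≤ 2} := by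
      rintro X ⟨hXE, hX3, hXr, heX⟩
      refine ⟨fun x hx => ⟨hXE hx, fun hxe => heX ?_⟩, hX3, hXr⟩
      rw [mem_singleton_iff.mp hxe] at hx
      exact hx
    exact (Set.ncard_le_ncard hsub (hEfin.finite_subsets.subset (fun X hX => hX.1.trans sdiff_subset))).trans
      (hB e heE)
  have hsumR : ∑ X ∈ 𝒯, (E'.bipartiteBelow (fun (e : α) (X : Finset α) => e ∉ X) X).card =
      𝒯.card * (E'.card - 3) := by
    rw [Finset.sum_congr rfl hR, Finset.sum_const, smul_eq_mul]
  have hsumL : ∑ e ∈ E', (𝒯.bipartiteAbove (fun (e : α) (X : Finset α) => e ∉ X) e).card ≤ E'.card * B := by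
    calc ∑ e ∈ E', (𝒯.bipartiteAbove (fun (e : α) (X : Finset α) => e ∉ X) e).card
        ≤ ∑ _e ∈ E', B := Finset.sum_le_sum hL
      _ = E'.card * B := by rw [Finset.sum_const, smul_eq_mul]
  rw [key, hsumR] at hsumL
  rw [mul_comm]
  exact hsumL

/-- The arithmetic of the averaging step: `(n − 3)·c ≤ n·(C(ν, 3) + 1)` with `n ≥ ν + 3`, `ν ≥ 3` forces
`c ≤ C(ν + 1, 3) + 1` (`3·C(ν + 1, 3) = (ν + 1)·C(ν, 2)`, `C(ν, 2) ≥ 3`). -/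
theorem le_choose_succ_add_one_of_mul_le {n ν c : ℕ} (hν : 3 ≤ ν) (hn : ν + 3 ≤ n)
    (h : (n - 3) * c ≤ n * (ν.choose 3 + 1)) : c ≤ (ν + 1).choose 3 + 1 := by
  by_contra hc
  push Not at hc
  have hP : (ν + 1).choose 3 = ν.choose 2 + ν.choose 3 := Nat.choose_succ_succ' ν 2
  have h3 : (ν + 1) * ν.choose 2 = (ν + 1).choose 3 * 3 := Nat.add_one_mul_choose_eq ν 2
  have hq : 3 ≤ ν.choose 2 := by
    have := Nat.choose_le_choose 2 hν
    simpa using this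
  obtain ⟨m, rfl⟩ : ∃ m, n = m + 3 := ⟨n - 3, by omega⟩
  rw [Nat.add_sub_cancel] at h
  have hm : ν ≤ m := by omega
  have h1 : m * ((ν + 1).choose 3 + 2) ≤ (m + 3) * (ν.choose 3 + 1) :=
    (Nat.mul_le_mul_left m hc).trans h
  have h2 : ν * ν.choose 2 ≤ m * ν.choose 2 := Nat.mul_le_mul_right _ hm
  nlinarith [h1, h2, h3, hP, hq, hm, hν]

/-- **THE INDUCTION STEP**: the cap at nullity `ν ≥ 3` on `n ≥ ν + 3` points from any cap `c₃ ≤ C(ν, 3) + 1`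
for simple coloop-free matroids of nullity `ν − 1` on `≥ (ν − 1) + 3` points. -/
theorem ncard_three_eRk_le_two_le_choose_succ_add_one_of_cap (M : Matroid α) [M.Finite] {ν : ℕ}
    (hd : M.E.encard = M.eRank + (ν : ℕ∞)) (hK : ∀ e, ¬ M.IsColoop e)
    (h0 : {P : Set α | P ⊆ M.E ∧ P.ncard = 2 ∧ M.Dep P}.ncard = 0) (hν : 3 ≤ ν) (hn : ν + 3 ≤ M.E.ncard)
    (hcap : ∀ (N : Matroid α) [N.Finite], N.E.encard = N.eRank + ((ν - 1 : ℕ) : ℕ∞) →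
      (∀ x, ¬ N.IsColoop x) → {P : Set α | P ⊆ N.E ∧ P.ncard = 2 ∧ N.Dep P}.ncard = 0 →
      ν - 1 + 3 ≤ N.E.ncard →
      {X : Set α | X ⊆ N.E ∧ X.ncard = 3 ∧ N.eRk X ≤ 2}.ncard ≤ ν.choose 3 + 1) :
    {X : Set α | X ⊆ M.E ∧ X.ncard = 3 ∧ M.eRk X ≤ 2}.ncard ≤ (ν + 1).choose 3 + 1 := by
  by_cases hser : ∃ e ∈ M.E, ∃ f ∈ M.E, e ≠ f ∧ f ∉ M.closure (M.E \ {e, f})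
  · -- a series pair: at most one triangle through `e`
    obtain ⟨e, he, f, hf, hef, h⟩ := hser
    have h1 := ncard_three_eRk_le_two_le_sdiff_add M e
    have h2 := ncard_three_eRk_le_two_sdiff_le_choose M hd hK h0 he (by omega)
    have h3 := ncard_three_eRk_le_two_mem_le_one M hK h0 he hf hef h
    omega
  · -- no series pair: every `M ↾ (E ∖ e)` is coloop-free; average
    push Not at hser
    have hB : ∀ e ∈ M.E, {X : Set α | X ⊆ M.E \ {e} ∧ X.ncard = 3 ∧ M.eRk X ≤ 2}.ncard ≤ ν.choose 3 + 1 :=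
      fun e he => ncard_three_eRk_le_two_sdiff_le_of_cap M hd hK h0 he
        (fun f hf hfe => hser e he f hf (Ne.symm hfe)) hcap hn (by omega)
    exact le_choose_succ_add_one_of_mul_le hν hn (mul_ncard_three_eRk_le_two_le M hB)

/-- **THE TRIANGLE CAP FOR EVERY `n ≥ ν + 3`**: a simple (no dependent pair), coloop-free matroid of nullity
`ν ≥ 3` on `n ≥ ν + 3` points has at most `C(ν + 1, 3) + 1` triangles (`3`-sets of rank `≤ 2`). -/
theorem ncard_three_eRk_le_two_le_choose_succ_add_one_of_add_three_le :
    ∀ ν : ℕ, 3 ≤ ν → ∀ (M : Matroid α) [M.Finite], M.E.encard = M.eRank + (ν : ℕ∞) →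
      (∀ e, ¬ M.IsColoop e) → {P : Set α | P ⊆ M.E ∧ P.ncard = 2 ∧ M.Dep P}.ncard = 0 →
      ν + 3 ≤ M.E.ncard →
      {X : Set α | X ⊆ M.E ∧ X.ncard = 3 ∧ M.eRk X ≤ 2}.ncard ≤ (ν + 1).choose 3 + 1 := by
  intro ν hν
  induction ν, hν using Nat.le_induction with
  | base =>
    intro M _ hd hK h0 hn
    refine ncard_three_eRk_le_two_le_choose_succ_add_one_of_cap M hd hK h0 le_rfl hn ?_
    intro N _ hd' hK' h0' hn'
    have := ncard_three_eRk_le_two_le_choose_succ_add_one' N hd' hK' h0' (by omega)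
    simpa using this
  | succ ν hν ih =>
    intro M _ hd hK h0 hn
    refine ncard_three_eRk_le_two_le_choose_succ_add_one_of_cap M hd hK h0 (by omega) hn ?_
    intro N _ hd' hK' h0' hn'
    rw [Nat.add_sub_cancel] at hd' hn'
    exact ih N hd' hK' h0' hn'

/-- The cap in the usual hypothesis form: `ν ≥ 3`, `n ≥ ν + 3`. -/
theorem ncard_three_eRk_le_two_le_choose_succ_add_one'' (M : Matroid α) [M.Finite] {ν : ℕ}
    (hd : M.E.encard = M.eRank + (ν : ℕ∞)) (hK : ∀ e, ¬ M.IsColoop e)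
    (h0 : {P : Set α | P ⊆ M.E ∧ P.ncard = 2 ∧ M.Dep P}.ncard = 0) (hν : 3 ≤ ν) (hn : ν + 3 ≤ M.E.ncard) :
    {X : Set α | X ⊆ M.E ∧ X.ncard = 3 ∧ M.eRk X ≤ 2}.ncard ≤ (ν + 1).choose 3 + 1 :=
  ncard_three_eRk_le_two_le_choose_succ_add_one_of_add_three_le ν hν M hd hK h0 hn

/-- `c₃ ≤ 21` at nullity `5` on `n ≥ 8` points. -/
theorem triangles_le_twentyone_of_nullity_five'' (M : Matroid α) [M.Finite]
    (hd : M.E.encard = M.eRank + 5) (hK : ∀ e, ¬ M.IsColoop e)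
    (h0 : {P : Set α | P ⊆ M.E ∧ P.ncard = 2 ∧ M.Dep P}.ncard = 0) (hn : 8 ≤ M.E.ncard) :
    {X : Set α | X ⊆ M.E ∧ X.ncard = 3 ∧ M.eRk X ≤ 2}.ncard ≤ 21 := by
  have := ncard_three_eRk_le_two_le_choose_succ_add_one'' M (ν := 5) (by exact_mod_cast hd) hK h0
    (by norm_num) (by omega)
  exact this.trans (by decide)

/-- `c₃ ≤ 36` at nullity `6` on `n ≥ 9` points (the `(6, 12)` residual of the row `p = 11`). -/
theorem triangles_le_thirtysix_of_nullity_six'' (M : Matroid α) [M.Finite]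
    (hd : M.E.encard = M.eRank + 6) (hK : ∀ e, ¬ M.IsColoop e)
    (h0 : {P : Set α | P ⊆ M.E ∧ P.ncard = 2 ∧ M.Dep P}.ncard = 0) (hn : 9 ≤ M.E.ncard) :
    {X : Set α | X ⊆ M.E ∧ X.ncard = 3 ∧ M.eRk X ≤ 2}.ncard ≤ 36 := by
  have := ncard_three_eRk_le_two_le_choose_succ_add_one'' M (ν := 6) (by exact_mod_cast hd) hK h0
    (by norm_num) (by omega)
  exact this.trans (by decide)

/-- `c₃ ≤ 57` at nullity `7` on `n ≥ 10` points. -/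
theorem triangles_le_fiftyseven_of_nullity_seven'' (M : Matroid α) [M.Finite]
    (hd : M.E.encard = M.eRank + 7) (hK : ∀ e, ¬ M.IsColoop e)
    (h0 : {P : Set α | P ⊆ M.E ∧ P.ncard = 2 ∧ M.Dep P}.ncard = 0) (hn : 10 ≤ M.E.ncard) :
    {X : Set α | X ⊆ M.E ∧ X.ncard = 3 ∧ M.eRk X ≤ 2}.ncard ≤ 57 := by
  have := ncard_three_eRk_le_two_le_choose_succ_add_one'' M (ν := 7) (by exact_mod_cast hd) hK h0
    (by norm_num) (by omega)
  exact this.trans (by decide)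

end S1CFG

end PercRepro
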